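import Summits.CriticalPhenomena.PercolationContinuityZ3.Theorems.PercNearOneGluingNoHeavyQuantFarTwoHubReach
import HarnessLib

/-!
# QUANT lane R8, front "FAR beyond trees", layer one — HUB FAMILIES I: a pendant block whose core carries ANY NUMBER of hubs
# (reachability through the anchors and the count decomposition `X = Σ_j 𝟙[E_j]·W_j`)

builds on p205010 (kernel theorem, internal audit signed; external expert review pending)

Support file (`--supports stmt-CriticalPhenomena-4575`), seat `prim-quant-p1` (gen 22); memo
`run/shared/lean/prim/quant/prim-quant-p1-g22/FOR-LEAD-KHUB.md` §1 (the k-hub graph transfer asked for in p1 g21's memo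
`FOR-LEAD-CYCDEC.md` §6(5)).  Pure combinatorics of open paths (no measure); standard axioms; no sorries.

`…QuantFarTwoHubReach` treated a block `Z` pendant at `c` with TWO anchors carrying hubs.  Here the block carries a whole FAMILY of hubs:
for `j ∈ J` a vertex set `S j ⊆ Z` ("hub": joined only to `S j ∪ {v j}`) hangs at the anchor `v j ∈ Z`; anchors are pairwise distinct and off
all hubs, hubs pairwise disjoint (`Block.IsHubFamily`); the CORE is whatever is left (`core Z (hubs J S) ω` = the open pairs meeting `Z` and
avoiding every hub).  On a configuration good for every hub (`Block.Good (v j) (S j) ω`):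
* `Block.reach_off_hubs_iff` — a vertex off a family of good hubs is reached iff it is reached off the hubs;
* `Block.on_reach_hub_iff_family` — for `a ∈ S j`: `c ↔ a on Z` iff `c ↔ v j` through the core and `v j ↔ a` inside `S j ∪ {v j}`;
  `Block.on_reach_iff_core_family` — a non-hub block vertex is reached on `Z` iff it is reached through the core;
* **`Block.card_on_eq_family`** — if every block relay is an anchor or a hub vertex,
  `#{a ∈ A ∩ Z : c ↔ a on Z} = Σ_{j ∈ J} 𝟙[c ↔ v j in core]·(Y_j + 𝟙[v j ∈ A])`, `Y_j = #{a ∈ A ∩ S j : v j ↔ a inside}`.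
This is the core-agnostic half of the k-hub transfer (pendant cycles: `…QuantFarCycleBlock*`; other 2-connected cores later).
[cite: Grimmett1999, §1.3 p. 10] (open paths); bookkeeping [this work].
-/

namespace Summit.CriticalPhenomena.PercolationContinuityZ3.Theorems

namespace Quant

namespace Block

open Finset
open Literature.Probability.Percolation
open Bundle (offZ offZ_subset reachable_of_offZ)
open scoped Classical

variable {n : ℕ}

/-- The data of a HUB FAMILY on a block `Z` pendant at `c`: for `j ∈ J` the hub `S j ⊆ Z` hangs at the anchor `v j ∈ Z`; anchors are
pairwise distinct and lie in no hub; distinct hubs are disjoint. [this work] -/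
structure IsHubFamily (c : Fin n) (Z : Finset (Fin n)) (J : Finset ℕ) (v : ℕ → Fin n) (S : ℕ → Finset (Fin n)) : Prop where
  cZ : c ∉ Z
  SZ : ∀ j ∈ J, S j ⊆ Z
  vZ : ∀ j ∈ J, v j ∈ Z
  vS : ∀ i ∈ J, ∀ j ∈ J, v i ∉ S j
  vinj : ∀ i ∈ J, ∀ j ∈ J, v i = v j → i = j
  disj : ∀ i ∈ J, ∀ j ∈ J, i ≠ j → Disjoint (S i) (S j)

/-- The union of the hubs of a family. [this work] -/
def hubs (J : Finset ℕ) (S : ℕ → Finset (Fin n)) : Finset (Fin n) := J.biUnion S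

/-- `hubs (insert i I) S = S i ∪ hubs I S`. [this work] -/
theorem hubs_insert (i : ℕ) (I : Finset ℕ) (S : ℕ → Finset (Fin n)) : hubs (insert i I) S = S i ∪ hubs I S := by
  unfold hubs; rw [Finset.biUnion_insert]

/-- Membership in `hubs`. [this work] -/
theorem mem_hubs {J : Finset ℕ} {S : ℕ → Finset (Fin n)} {x : Fin n} : x ∈ hubs J S ↔ ∃ j ∈ J, x ∈ S j := by
  unfold hubs; rw [Finset.mem_biUnion]

/-! ## Removing hubs one at a time -/

/-- `offZ ∅ η = η`. [this work] -/
theorem offZ_empty (η : BondConfig (Fin n)) : offZ (∅ : Finset (Fin n)) η = η := by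
  ext e
  simp only [offZ, Finset.notMem_empty, false_implies, implies_true, and_true, Set.mem_setOf_eq]

/-- `offZ (U ∪ V) η = offZ U (offZ V η)`. [this work] -/
theorem offZ_union (U V : Finset (Fin n)) (η : BondConfig (Fin n)) : offZ (U ∪ V) η = offZ U (offZ V η) := by
  ext e
  simp only [offZ, Set.mem_setOf_eq, Finset.mem_union]
  constructor
  · rintro ⟨he, h⟩
    exact ⟨⟨he, fun z hz => h z (Or.inr hz)⟩, fun z hz => h z (Or.inl hz)⟩
  · rintro ⟨⟨he, hV⟩, hU⟩
    exact ⟨he, fun z hz => hz.elim (hU z) (hV z)⟩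

/-- `offZ H (onZ Z ω) = core Z H ω`. [this work] -/
theorem offZ_onZ_eq_core (Z H : Finset (Fin n)) (ω : BondConfig (Fin n)) : offZ H (onZ Z ω) = core Z H ω := by
  ext e
  simp only [offZ, onZ, core, Set.mem_setOf_eq]
  constructor
  · rintro ⟨⟨he, hz⟩, h⟩; exact ⟨he, hz, h⟩
  · rintro ⟨he, hz, h⟩; exact ⟨⟨he, hz⟩, h⟩

/-- **A vertex off a family of good hubs is reached iff it is reached off the hubs** (observer `o` and target `y` off every hub of
the family). [this work] -/
theorem reach_off_hubs_iff (v : ℕ → Fin n) (S : ℕ → Finset (Fin n)) {o y : Fin n} :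
    ∀ (I : Finset ℕ) (η : BondConfig (Fin n)), (∀ i ∈ I, Good (v i) (S i) η) → (∀ i ∈ I, o ∉ S i) → (∀ i ∈ I, y ∉ S i) →
      ((openGraph η).Reachable o y ↔ (openGraph (offZ (hubs I S) η)).Reachable o y) := by
  intro I
  induction I using Finset.induction_on with
  | empty =>
    intro η _ _ _
    unfold hubs; rw [Finset.biUnion_empty, offZ_empty]
  | insert i I hi ih =>
    intro η hgood ho hy
    rw [hubs_insert, Finset.union_comm, offZ_union]
    have step : (openGraph η).Reachable o y ↔ (openGraph (offZ (S i) η)).Reachable o y :=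
      reach_off_iff (hgood i (Finset.mem_insert_self i I)) (ho i (Finset.mem_insert_self i I)) (hy i (Finset.mem_insert_self i I))
    rw [step]
    exact ih (offZ (S i) η) (fun i' hi' => good_mono (offZ_subset _ _) (hgood i' (Finset.mem_insert_of_mem hi')))
      (fun i' hi' => ho i' (Finset.mem_insert_of_mem hi')) (fun i' hi' => hy i' (Finset.mem_insert_of_mem hi'))

section Family

variable {c : Fin n} {Z : Finset (Fin n)} {J : Finset ℕ} {v : ℕ → Fin n} {S : ℕ → Finset (Fin n)} (H : IsHubFamily c Z J v S)
include H

/-- The cut vertex lies in no hub. [this work] -/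
theorem c_notMem_hub {j : ℕ} (hj : j ∈ J) : c ∉ S j := fun h => H.cZ (H.SZ j hj h)

/-- **Hub vertices are reached through their anchor.**  For `a ∈ S j` and a configuration good for every hub of the family:
`c ↔ a on Z` iff `c ↔ v j` through the core and `v j ↔ a` by the inner pairs of `S j`. [this work] -/
theorem on_reach_hub_iff_family {ω : BondConfig (Fin n)} (hgood : ∀ i ∈ J, Good (v i) (S i) ω) {j : ℕ} (hj : j ∈ J)
    {a : Fin n} (ha : a ∈ S j) :
    (openGraph (onZ Z ω)).Reachable c a ↔
      (openGraph (core Z (hubs J S) ω)).Reachable c (v j) ∧ (openGraph (inS (S j) (v j) ω)).Reachable (v j) a := by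
  -- block `S j` at `v j` inside the configuration `onZ Z ω`, observer `c`
  have g₁ : Good (v j) (S j) (onZ Z ω) := good_mono (onZ_subset Z ω) (hgood j hj)
  have step1 := reach_in_iff g₁ (c_notMem_hub H hj) (H.vS j hj j hj) ha
  rw [onZ_onZ (H.SZ j hj), onZ_eq_inS (hgood j hj)] at step1
  rw [step1]
  -- remove the other hubs from `offZ (S j) (onZ Z ω)`
  have step2 := reach_off_hubs_iff v S (o := c) (y := v j) (J.erase j) (offZ (S j) (onZ Z ω))
    (fun i hi => good_mono (fun e he => (onZ_subset Z ω) ((offZ_subset _ _) he)) (hgood i (Finset.mem_of_mem_erase hi)))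
    (fun i hi => c_notMem_hub H (Finset.mem_of_mem_erase hi)) (fun i hi => H.vS j hj i (Finset.mem_of_mem_erase hi))
  have hset : offZ (hubs (J.erase j) S) (offZ (S j) (onZ Z ω)) = core Z (hubs J S) ω := by
    rw [← offZ_union, offZ_onZ_eq_core, Finset.union_comm, ← hubs_insert, Finset.insert_erase hj]
  rw [hset] at step2
  rw [step2]

/-- **A block vertex off every hub is reached on `Z` iff it is reached through the core.** [this work] -/
theorem on_reach_iff_core_family {ω : BondConfig (Fin n)} (hgood : ∀ i ∈ J, Good (v i) (S i) ω) {y : Fin n}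
    (hy : ∀ i ∈ J, y ∉ S i) :
    (openGraph (onZ Z ω)).Reachable c y ↔ (openGraph (core Z (hubs J S) ω)).Reachable c y := by
  have h := reach_off_hubs_iff v S (o := c) (y := y) J (onZ Z ω) (fun i hi => good_mono (onZ_subset Z ω) (hgood i hi))
    (fun i hi => c_notMem_hub H hi) hy
  rw [offZ_onZ_eq_core] at h
  exact h

/-- **The block count of a hub family.**  If every block relay is an anchor or a hub vertex, then on a configuration good for every hub
`#{a ∈ A ∩ Z : c ↔ a on Z} = Σ_{j ∈ J} 𝟙[c ↔ v j in core]·(Y_j + 𝟙[v j ∈ A])`, `Y_j = #{a ∈ A ∩ S j : v j ↔ a by the inner pairs of S j}`.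
[this work] -/
theorem card_on_eq_family {ω : BondConfig (Fin n)} (hgood : ∀ i ∈ J, Good (v i) (S i) ω) {A : Finset (Fin n)}
    (hA : ∀ a ∈ A ∩ Z, ∃ j ∈ J, a = v j ∨ a ∈ S j) :
    ((A ∩ Z).filter fun a => onZ Z ω ∈ openConn c a).card =
      ∑ j ∈ J, (if core Z (hubs J S) ω ∈ openConn c (v j) then
        ((A ∩ S j).filter fun a => inS (S j) (v j) ω ∈ openConn (v j) a).card + (if v j ∈ A then 1 else 0) else 0) := by
  set R : Fin n → Prop := fun a => onZ Z ω ∈ openConn c a with hR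
  set piece : ℕ → Finset (Fin n) := fun j => (A ∩ insert (v j) (S j)).filter R with hpiece
  -- the relays split over the hubs-with-anchor
  have hsplit : (A ∩ Z).filter R = J.biUnion piece := by
    ext a
    rw [Finset.mem_biUnion, Finset.mem_filter]
    constructor
    · rintro ⟨haZ, hr⟩
      obtain ⟨j, hj, h⟩ := hA a haZ
      refine ⟨j, hj, Finset.mem_filter.2 ⟨Finset.mem_inter.2 ⟨(Finset.mem_inter.1 haZ).1, ?_⟩, hr⟩⟩
      rcases h with rfl | h
      · exact Finset.mem_insert_self _ _
      · exact Finset.mem_insert_of_mem h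
    · rintro ⟨j, hj, ha⟩
      obtain ⟨ha', hr⟩ := Finset.mem_filter.1 ha
      obtain ⟨haA, hav⟩ := Finset.mem_inter.1 ha'
      refine ⟨Finset.mem_inter.2 ⟨haA, ?_⟩, hr⟩
      rcases Finset.mem_insert.1 hav with rfl | h
      · exact H.vZ j hj
      · exact H.SZ j hj h
  have hdisj : (J : Set ℕ).PairwiseDisjoint piece := by
    intro i hi j hj hij
    rw [Function.onFun, Finset.disjoint_left]
    intro a hai haj
    have hai' := (Finset.mem_inter.1 (Finset.mem_filter.1 hai).1).2
    have haj' := (Finset.mem_inter.1 (Finset.mem_filter.1 haj).1).2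
    rcases Finset.mem_insert.1 hai' with rfl | ha1 <;> rcases Finset.mem_insert.1 haj' with h2 | ha2
    · exact hij (H.vinj i hi j hj h2)
    · exact H.vS i hi j hj ha2
    · exact H.vS j hj i hi (h2 ▸ ha1)
    · exact Finset.disjoint_left.1 (H.disj i hi j hj hij) ha1 ha2
  rw [hsplit, Finset.card_biUnion hdisj]
  refine Finset.sum_congr rfl fun j hj => ?_
  -- one hub with its anchor
  have hvS : v j ∉ S j := H.vS j hj j hj
  have hpj : piece j = (({v j} : Finset (Fin n)).filter fun a => a ∈ A ∧ R a) ∪ (A ∩ S j).filter R := by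
    ext a
    simp only [hpiece, Finset.mem_filter, Finset.mem_union, Finset.mem_inter, Finset.mem_insert, Finset.mem_singleton]
    constructor
    · rintro ⟨⟨haA, rfl | haS⟩, hr⟩
      · exact Or.inl ⟨rfl, haA, hr⟩
      · exact Or.inr ⟨⟨haA, haS⟩, hr⟩
    · rintro (⟨rfl, haA, hr⟩ | ⟨⟨haA, haS⟩, hr⟩)
      · exact ⟨⟨haA, Or.inl rfl⟩, hr⟩
      · exact ⟨⟨haA, Or.inr haS⟩, hr⟩
  have hd : Disjoint (({v j} : Finset (Fin n)).filter fun a => a ∈ A ∧ R a) ((A ∩ S j).filter R) := by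
    rw [Finset.disjoint_left]
    intro a h1 h2
    have h1' := (Finset.mem_filter.1 h1).1
    rw [Finset.mem_singleton] at h1'
    exact hvS (h1' ▸ (Finset.mem_inter.1 (Finset.mem_filter.1 h2).1).2)
  rw [hpj, Finset.card_union_of_disjoint hd, Finset.card_filter, Finset.sum_singleton]
  have rv : R (v j) ↔ core Z (hubs J S) ω ∈ openConn c (v j) := on_reach_iff_core_family H hgood (fun i hi => H.vS j hj i hi)
  by_cases hE : core Z (hubs J S) ω ∈ openConn c (v j)
  · rw [if_pos hE]
    have hc : ((A ∩ S j).filter R).card = ((A ∩ S j).filter fun a => inS (S j) (v j) ω ∈ openConn (v j) a).card := by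
      refine congrArg _ (Finset.filter_congr fun a ha => ?_)
      change (openGraph (onZ Z ω)).Reachable c a ↔ _
      rw [on_reach_hub_iff_family H hgood hj (Finset.mem_inter.1 ha).2]
      exact ⟨fun h => h.2, fun h => ⟨hE, h⟩⟩
    rw [hc]
    by_cases hvA : v j ∈ A
    · rw [if_pos ⟨hvA, rv.2 hE⟩, if_pos hvA]; omega
    · rw [if_neg (fun h => hvA h.1), if_neg hvA]; omega
  · rw [if_neg hE]
    have hc : ((A ∩ S j).filter R).card = 0 := by
      rw [Finset.card_eq_zero, Finset.filter_eq_empty_iff]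
      intro a ha h
      exact hE ((on_reach_hub_iff_family H hgood hj (Finset.mem_inter.1 ha).2).1 h).1
    rw [hc, if_neg (fun h => hE (rv.1 h.2))]

end Family

end Block

end Quant

end Summit.CriticalPhenomena.PercolationContinuityZ3.Theorems
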